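import Mathlib
import Literature.NumberTheory.GaloisRepresentations.HeckeCharacterNormCharacter
import Literature.NumberTheory.GaloisRepresentations.HeckeCharacterAutConj
import Literature.NumberTheory.GaloisRepresentations.CubicReciprocityRationalPrime
import Literature.NumberTheory.Automorphic.HenniartAutomorphicInductionProofs
import Summits.Langlands.Langlands.Theorems.PicardMuOrdinaryResidualAutomorphyEvenHeckeAlgebra
import Summits.Langlands.Langlands.Theorems.PicardMuOrdinaryResidualAutomorphyEvenTeichmullerTwist
import Summits.Langlands.Langlands.Theorems.PicardMuOrdinaryResidualAutomorphyEvenThetaDatum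

/-!
# The algebraic Hecke character `θ = ε · ψ · χ₀` of the CM cubic resolvent field

Helper file for item stmt-Langlands-13760 (route `PicardMuOrdinary`, decl `ResidualAutomorphyEven`).
For `f ∈ ℤ[X]` of degree `4`, separable, `12 ∣ #Gal(f)`, four real roots, let `K = ℚ(ω)`, `E` the cubic
resolvent field over `K` (a CM sextic), `ε` the quadratic Hecke character of `E` of the `Epsilon` file and
`𝔐 ∋ 3` a maximal ideal of `ℤ̄`.  **Main theorem** (`exists_theta`): there are a UNITARY Hecke character
`θ` of `E` and an (algebraic) infinity type `(p, q)` of `θ` such that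

* (regularity) for every embedding `σ : K → ℂ` the exponents `-n_{σ'}` (`n = embExponent p q`) at the
  three embeddings `σ' : E → ℂ` above `σ` are pairwise distinct (they are `{1, 0, -1}`);
* (congruence) for almost every place `w` of `E`, `θ` is unramified at `w` and `N w · θ(ϖ_w)` is an
  algebraic integer `≡ ε(ϖ_w) (mod 𝔐)`;
* (cuspidality datum) there are `v` and `w ≠ w'` above `v` of the same degree, unramified for `θ`, with
  `θ(ϖ_w) ≠ θ(ϖ_{w'})`.

Construction: `θ = ε ψ χ₀` with `ψ` a unitary Hecke character of `E` of unitary archimedean type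
`(2k, 0)` (`exists_psi`, `E` is CM), `k_w = -n(σ_w)` for an odd exponent function `n` on the embeddings
taking the values `1, 0, -1` above a fixed `σ₀ : K → ℂ` (so `ψ` has infinity type `(-k, k)` with
`embExponent (-k) k = n` and `|k| ≤ 1`), and `χ₀` the Teichmüller twist of `ψ` modulo `𝔐`
(`exists_teichmuller_twist`: `N w ψ(ϖ_w) χ₀(ϖ_w) ≡ 1`), the datum coming from `exists_datum_of_congr`.
Unconditional.
-/

set_option linter.dupNamespace false -- project-wide option (lakefile weak.linter.dupNamespace); `Summit.Langlands.Langlands` is the mandated namespace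

noncomputable section

namespace Summit.Langlands.Langlands.Theorems.ResidualAutomorphyEven

open Polynomial Finset NumberField NumberField.InfinitePlace IsDedekindDomain Filter
open Literature.NumberTheory.GaloisRepresentations Literature.NumberTheory.Automorphic
  Literature.NumberTheory.LFunctions
open scoped Classical

/-! ### Exponent functions on the embeddings of a totally complex field -/

section Exponents

variable {L : Type*} [Field L] [NumberField L] [IsTotallyComplex L]

omit [NumberField L] in
/-- In a totally complex field no complex embedding is real. -/
theorem not_isReal_of_isTotallyComplex (φ : L →+* ℂ) : ¬ ComplexEmbedding.IsReal φ := fun hφ =>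
  (InfinitePlace.not_isReal_iff_isComplex.mpr (IsTotallyComplex.isComplex (InfinitePlace.mk φ))) ⟨φ, hφ, rfl⟩

omit [NumberField L] in
/-- **`embExponent (-k) k = n`** for an odd exponent function `n` (`n(σ̄) = -n(σ)`) on a totally complex
field, with `k_w = -n(σ_w)`. -/
theorem embExponent_eq_of_odd (n : (L →+* ℂ) → ℤ) (hn : ∀ φ, n (ComplexEmbedding.conjugate φ) = -n φ)
    (φ : L →+* ℂ) :
    HeckeCharacter.embExponent (fun w : InfinitePlace L => -(-n w.embedding)) (fun w => -n w.embedding) φ = n φ := by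
  unfold HeckeCharacter.embExponent
  rw [if_neg (not_isReal_of_isTotallyComplex φ)]
  dsimp only
  have hmk : InfinitePlace.mk φ = InfinitePlace.mk (InfinitePlace.mk φ).embedding := by rw [mk_embedding]
  rcases mk_eq_iff.mp hmk with h1 | h1
  · rw [if_pos h1, neg_neg]
    exact congrArg n h1.symm
  · have h2 : φ ≠ (InfinitePlace.mk φ).embedding := by
      intro h3
      exact not_isReal_of_isTotallyComplex φ (ComplexEmbedding.isReal_iff.mpr (h1.trans h3.symm))
    rw [if_neg h2]
    have h4 : n (InfinitePlace.mk φ).embedding = -n φ := by rw [← h1, hn]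
    rw [h4, neg_neg]

end Exponents

/-! ### The embeddings of `K = ℚ(ω)` -/

/-- `K = ℚ(ω)` has no real embedding. -/
theorem not_isReal_K (σ : K →+* ℂ) : ¬ ComplexEmbedding.IsReal σ := by
  intro hσ
  haveI : IsCyclotomicExtension {3} ℚ (CyclotomicField 3 ℚ) := CyclotomicField.isCyclotomicExtension 3 ℚ
  have hζ := IsCyclotomicExtension.zeta_spec 3 ℚ K
  set ζ : K := IsCyclotomicExtension.zeta 3 ℚ K
  have hζ1 : ζ ≠ 1 := hζ.ne_one (by norm_num)
  have hsum : ζ ^ 2 + ζ + 1 = 0 := by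
    have h3 : ζ ^ 3 = 1 := hζ.pow_eq_one
    have : (ζ - 1) * (ζ ^ 2 + ζ + 1) = 0 := by ring_nf; linear_combination h3
    rcases mul_eq_zero.mp this with h | h
    · exact absurd (sub_eq_zero.mp h) hζ1
    · exact h
  have h := congrArg hσ.embedding hsum
  rw [map_add, map_add, map_pow, map_one, map_zero] at h
  exact real_sq_add_self_add_one_ne_zero _ h

/-- Every embedding of `K` is `σ₀` or its conjugate. -/
theorem eq_or_eq_conjugate_K (σ₀ σ : K →+* ℂ) : σ = σ₀ ∨ σ = ComplexEmbedding.conjugate σ₀ := by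
  by_contra hcon
  push Not at hcon
  haveI : IsCyclotomicExtension {3} ℚ (CyclotomicField 3 ℚ) := CyclotomicField.isCyclotomicExtension 3 ℚ
  have hcard : Fintype.card (K →+* ℂ) = 2 := by
    rw [NumberField.Embeddings.card, finrank_eq_two_of_isCyclotomicExtension_three (K := K)]
  have hne : σ₀ ≠ ComplexEmbedding.conjugate σ₀ := fun h0 =>
    not_isReal_K σ₀ (ComplexEmbedding.isReal_iff.mpr h0.symm)
  have h3 : ({σ, σ₀, ComplexEmbedding.conjugate σ₀} : Finset (K →+* ℂ)).card = 3 := by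
    rw [card_insert_of_notMem (by simp [hcon.1, hcon.2]), card_pair hne]
  have := card_le_univ ({σ, σ₀, ComplexEmbedding.conjugate σ₀} : Finset (K →+* ℂ))
  rw [h3, hcard] at this
  omega

/-! ### The odd exponent function with values `{1, 0, -1}` above `σ₀` -/

section OddExponent

variable {f : ℤ[X]} (h : IsSepQuartic f)

/-- Conjugation on the embeddings of `E` commutes with restriction to `K`. -/
theorem conjugate_comp_algebraMap (σ' : E h →+* ℂ) :
    (ComplexEmbedding.conjugate σ').comp (algebraMap K (E h)) = ComplexEmbedding.conjugate (σ'.comp (algebraMap K (E h))) :=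
  rfl

/-- **An odd exponent function on the embeddings of `E` that is injective, with values in `{1, 0, -1}`,
on the embeddings above each embedding of `K`.** -/
theorem exists_odd_exponent (h12 : 12 ∣ Nat.card (G f)) :
    ∃ n : (E h →+* ℂ) → ℤ, (∀ φ, n (ComplexEmbedding.conjugate φ) = -n φ) ∧ (∀ φ, -1 ≤ n φ ∧ n φ ≤ 1) ∧
      ∀ σ : K →+* ℂ, Set.InjOn n {σ' : E h →+* ℂ | σ'.comp (algebraMap K (E h)) = σ} := by
  -- a fixed embedding of `K` and the three embeddings of `E` above it
  set σ₀ : K →+* ℂ := Classical.arbitrary (K →+* ℂ) with hσ₀def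
  clear_value σ₀
  set S₀ : Finset (E h →+* ℂ) := univ.filter fun σ' => σ'.comp (algebraMap K (E h)) = σ₀ with hS₀
  have hcard : S₀.card = 3 := by rw [hS₀, card_filter_comp_algebraMap_eq' σ₀, finrank_E h h12]
  set e : (E h →+* ℂ) → ℤ := fun σ' => if hσ' : σ' ∈ S₀ then ((S₀.equivFin ⟨σ', hσ'⟩ : ℕ) : ℤ) - 1 else 0 with he
  have he_bd : ∀ φ, -1 ≤ e φ ∧ e φ ≤ 1 := fun φ => by
    simp only [he]
    split_ifs with hφ
    · have := (S₀.equivFin ⟨φ, hφ⟩).2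
      omega
    · omega
  have he_inj : Set.InjOn e (S₀ : Set (E h →+* ℂ)) := by
    intro a ha b hb hab
    simp only [he, dif_pos (mem_coe.mp ha), dif_pos (mem_coe.mp hb)] at hab
    have h1 : ((S₀.equivFin ⟨a, ha⟩ : ℕ)) = (S₀.equivFin ⟨b, hb⟩ : ℕ) := by omega
    have h2 : S₀.equivFin ⟨a, ha⟩ = S₀.equivFin ⟨b, hb⟩ := Fin.ext h1
    have h3 := (S₀.equivFin).injective h2
    exact congrArg Subtype.val h3
  have hne : σ₀ ≠ ComplexEmbedding.conjugate σ₀ := fun h0 =>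
    not_isReal_K σ₀ (ComplexEmbedding.isReal_iff.mpr h0.symm)
  have hmem : ∀ φ : E h →+* ℂ, φ ∈ S₀ ↔ φ.comp (algebraMap K (E h)) = σ₀ := fun φ => by
    rw [hS₀, mem_filter]; simp
  -- the odd extension
  refine ⟨fun φ => if φ.comp (algebraMap K (E h)) = σ₀ then e φ else -e (ComplexEmbedding.conjugate φ),
    fun φ => ?_, fun φ => ?_, fun σ => ?_⟩
  · by_cases hφ : φ.comp (algebraMap K (E h)) = σ₀
    · have hφ' : ¬ (ComplexEmbedding.conjugate φ).comp (algebraMap K (E h)) = σ₀ := by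
        rw [conjugate_comp_algebraMap, hφ]; exact hne.symm
      simp only [if_pos hφ, if_neg hφ', ComplexEmbedding.involutive_conjugate _ φ]
    · by_cases hφ' : (ComplexEmbedding.conjugate φ).comp (algebraMap K (E h)) = σ₀
      · simp only [if_neg hφ, if_pos hφ', neg_neg]
      · -- impossible: `φ|K` is `σ₀` or `σ̄₀`
        exfalso
        rcases eq_or_eq_conjugate_K σ₀ (φ.comp (algebraMap K (E h))) with h1 | h1
        · exact hφ h1
        · apply hφ'
          rw [conjugate_comp_algebraMap, h1, ComplexEmbedding.involutive_conjugate _ σ₀]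
  · dsimp only
    split_ifs
    · exact he_bd φ
    · have := he_bd (ComplexEmbedding.conjugate φ); omega
  · intro a ha b hb hab
    dsimp only at hab
    simp only [Set.mem_setOf_eq] at ha hb
    rcases eq_or_eq_conjugate_K σ₀ σ with rfl | rfl
    · simp only [if_pos ha, if_pos hb] at hab
      exact he_inj (mem_coe.mpr ((hmem a).mpr ha)) (mem_coe.mpr ((hmem b).mpr hb)) hab
    · have ha' : ¬ a.comp (algebraMap K (E h)) = σ₀ := by rw [ha]; exact hne.symm
      have hb' : ¬ b.comp (algebraMap K (E h)) = σ₀ := by rw [hb]; exact hne.symm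
      have ha'' : (ComplexEmbedding.conjugate a).comp (algebraMap K (E h)) = σ₀ := by
        rw [conjugate_comp_algebraMap, ha, ComplexEmbedding.involutive_conjugate _ σ₀]
      have hb'' : (ComplexEmbedding.conjugate b).comp (algebraMap K (E h)) = σ₀ := by
        rw [conjugate_comp_algebraMap, hb, ComplexEmbedding.involutive_conjugate _ σ₀]
      simp only [if_neg ha', if_neg hb', neg_inj] at hab
      have := he_inj (mem_coe.mpr ((hmem _).mpr ha'')) (mem_coe.mpr ((hmem _).mpr hb'')) hab
      exact (ComplexEmbedding.involutive_conjugate (E h)).injective this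

end OddExponent

/-! ### The character `θ` -/

section Theta

variable {f : ℤ[X]}

/-- **The algebraic Hecke character `θ = ε ψ χ₀` of `E`** (see the module docstring): unitary, of an
infinity type `(p, q)` whose exponents above each embedding of `K` are pairwise distinct, congruent to `ε`
modulo `𝔐` in the normalisation `N w · θ(ϖ_w)` at almost every `w`, and carrying a cuspidality datum. -/
theorem exists_theta (hdeg : f.natDegree = 4) (hsep : (f.map (Int.castRingHom ℚ)).Separable)
    (hgal : 12 ∣ Nat.card (f.map (Int.castRingHom ℚ)).Gal) (hreal : (f.map (Int.castRingHom ℝ)).roots.card = 4)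
    (𝔐 : Ideal (integralClosure ℤ ℂ)) [h𝔐 : 𝔐.IsMaximal] (h3 : (3 : integralClosure ℤ ℂ) ∈ 𝔐) :
    ∃ (θ : HeckeCharacter (E (isSepQuartic_of_hyp hdeg hsep))) (p q : InfinitePlace (E (isSepQuartic_of_hyp hdeg hsep)) → ℤ),
      θ.IsUnitary ∧ θ.HasInfinityType p q ∧
      (∀ σ : K →+* ℂ, Set.InjOn (fun σ' => HeckeCharacter.embExponent p q σ')
        {σ' : E (isSepQuartic_of_hyp hdeg hsep) →+* ℂ | σ'.comp (algebraMap K (E (isSepQuartic_of_hyp hdeg hsep))) = σ}) ∧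
      (∀ᶠ w : HeightOneSpectrum (𝓞 (E (isSepQuartic_of_hyp hdeg hsep))) in cofinite, θ.IsUnramifiedAt w ∧
        ∃ z : integralClosure ℤ ℂ, algebraMap (integralClosure ℤ ℂ) ℂ z = (w.residueCard : ℂ) * θ.valueAtUniformizer w ∧
          Ideal.Quotient.mk 𝔐 z = Ideal.Quotient.mk 𝔐 (zlift ((eps (isSepQuartic_of_hyp hdeg hsep)
            (twelve_dvd_card_G_of_hyp hdeg hsep hgal hreal) (leadingCoeff_ne_zero_of_hyp hdeg)).valueAtUniformizer w))) ∧
      ∃ (v : HeightOneSpectrum (𝓞 K)) (w w' : HeightOneSpectrum (𝓞 (E (isSepQuartic_of_hyp hdeg hsep)))), w ≠ w' ∧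
        w.under (𝓞 K) = v ∧ w'.under (𝓞 K) = v ∧
        w.asIdeal.inertiaDeg (𝓞 K) = w'.asIdeal.inertiaDeg (𝓞 K) ∧
        θ.IsUnramifiedAt w ∧ θ.IsUnramifiedAt w' ∧ θ.valueAtUniformizer w ≠ θ.valueAtUniformizer w' := by
  set h : IsSepQuartic f := isSepQuartic_of_hyp hdeg hsep with hh
  have h12 : 12 ∣ Nat.card (G f) := twelve_dvd_card_G_of_hyp hdeg hsep hgal hreal
  have hlc : f.leadingCoeff ≠ 0 := leadingCoeff_ne_zero_of_hyp hdeg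
  haveI : IsTotallyComplex (E h) := isTotallyComplex_E h
  haveI := h𝔐.isPrime
  -- the odd exponent function and `ψ`
  obtain ⟨n, hodd, hbd, hinj⟩ := exists_odd_exponent h h12
  set k : InfinitePlace (E h) → ℤ := fun w => -n w.embedding with hk
  obtain ⟨ψ, hψu, hψarch⟩ := exists_psi h h12 hdeg hreal (fun w => 2 * k w) fun w => even_two_mul _
  have hψinf : ψ.HasInfinityType (fun w => -k w) k := hasInfinityType_of_hasUnitaryArchType_two_mul hψarch
  -- a module of definition divisible by `3` and the Teichmüller twist
  obtain ⟨T, e, hmod, hT⟩ := exists_isModulus_le_span ψ (ℓ := 3) (by norm_num)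
  have hp : ∀ w, 0 ≤ 1 + (fun w => -k w) w := fun w => by have := hbd w.embedding; simp only [hk]; omega
  have hq : ∀ w, 0 ≤ 1 + k w := fun w => by have := hbd w.embedding; simp only [hk]; omega
  obtain ⟨χ₀, hχ₀fin, hχ₀⟩ := exists_teichmuller_twist hψinf hmod hp hq Nat.prime_three hT h3
  -- `θ = ε ψ χ₀`
  set θ : HeckeCharacter (E h) := eps h h12 hlc * ψ * χ₀ with hθ
  have hεfin : (eps h h12 hlc).IsFiniteOrder := isFiniteOrder_eps h h12 hlc
  have hθu : θ.IsUnitary := (hεfin.isUnitary.mul hψu).mul hχ₀fin.isUnitary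
  have hθinf : θ.HasInfinityType (0 + (fun w => -k w) + 0) (0 + k + 0) :=
    HasInfinityType.mul' (HasInfinityType.mul' (hasInfinityType_zero_of_isFiniteOrder hεfin) hψinf)
      (hasInfinityType_zero_of_isFiniteOrder hχ₀fin)
  have hpq : HeckeCharacter.embExponent (0 + (fun w => -k w) + 0) (0 + k + 0) =
      HeckeCharacter.embExponent (fun w : InfinitePlace (E h) => -(-n w.embedding)) (fun w => -n w.embedding) := by
    congr 1 <;> funext w <;> simp [hk]
  -- the congruence at almost every place
  have hcong : ∀ᶠ w : HeightOneSpectrum (𝓞 (E h)) in cofinite, θ.IsUnramifiedAt w ∧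
      ∃ z : integralClosure ℤ ℂ, algebraMap (integralClosure ℤ ℂ) ℂ z = (w.residueCard : ℂ) * θ.valueAtUniformizer w ∧
        Ideal.Quotient.mk 𝔐 z = Ideal.Quotient.mk 𝔐 (zlift ((eps h h12 hlc).valueAtUniformizer w)) := by
    have hT' : ∀ᶠ w : HeightOneSpectrum (𝓞 (E h)) in cofinite, w ∉ T := by
      filter_upwards [T.finite_toSet.compl_mem_cofinite] with w hw
      exact fun hmem => hw (Finset.mem_coe.mpr hmem)
    filter_upwards [eventually_isUnramifiedAt' (eps h h12 hlc), hT'] with w hεw hwT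
    obtain ⟨hχ₀w, z, hz, hz1⟩ := hχ₀ w hwT
    have hψw : ψ.IsUnramifiedAt w := HeckeCharacter.isUnramifiedAt_of_isModulus' hmod hwT
    refine ⟨isUnramifiedAt_mul' (isUnramifiedAt_mul' hεw hψw) hχ₀w, zlift ((eps h h12 hlc).valueAtUniformizer w) * z, ?_, ?_⟩
    · rw [map_mul, algebraMap_zlift (isIntegral_valueAtUniformizer_eps h h12 hlc w), hz, hθ, valueAtUniformizer_mul',
        valueAtUniformizer_mul']
      ring
    · rw [map_mul, hz1, mul_one]
  -- `2 ∉ 𝔐`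
  have h2 : (2 : integralClosure ℤ ℂ) ∉ 𝔐 := fun h2 => by
    have : (1 : integralClosure ℤ ℂ) = 3 - 2 := by norm_num
    exact h𝔐.ne_top ((Ideal.eq_top_iff_one _).mpr (this ▸ 𝔐.sub_mem h3 h2))
  refine ⟨θ, 0 + (fun w => -k w) + 0, 0 + k + 0, hθu, hθinf, fun σ => ?_, hcong,
    exists_datum_of_congr h h12 hlc h2 θ hcong⟩
  -- regularity: the exponents above `σ` are `n`, injective there
  intro a ha b hb hab
  simp only [hpq, embExponent_eq_of_odd n hodd] at hab
  exact hinj σ ha hb hab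

end Theta

end Summit.Langlands.Langlands.Theorems.ResidualAutomorphyEven
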